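import Literature.NumberTheory.Weil1965.AdelicSiegelMeasureIntegral
import HarnessLib

/-!
# Weil's `E_X` for ANY map `h` that is a rational quadratic form: condition (B), cut-off continuity, `E_X = Σ_b μ_b`

Topic `NumberTheory/Weil1965`; namespace `Literature.NumberTheory.Weil1965`.  KERNEL mathematics only (theorems; no definition,
no named fact, no `axiom`, no `sorry`).  TRANSPORT file: ★ `AdelicSiegelCoeffHeightBound` (condition (B)), ★
`AdelicSiegelFunctionalCutoffContinuity` (cut-off continuity, `∫ Ψ dE_X = E_X Ψ` on `Ψ ≥ 0`, one cut-off sequence) and ★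
`AdelicSiegelMeasureIntegral` (`Σ_ξ F*_Φ(ξ) = ∫ Φ dE_X = Σ_b ∫ Φ dμ_b` on all of `𝒮`) are stated for the map
`h = fun x => sdForm F (ratMatrix F S) x`; consumers meet `h` as a DEFINED invariant (e.g. the hermitian norm `hNorm` of ★
`ThetaIntegralOrbitFunctionalUnitary`, a `def`) together with a lemma `∀ x, h x = q_S(x)` for a rational symmetric `S`.  Since
`adelicSiegelFunctional … h hh hB`, `adelicSiegelMeasure … h hh hB`, `adelicSiegelFibreMeasure … h hh hB b` DEPEND on `h`, the clean
way to consume is a version of every head with `h` free and the hypothesis `hhS : ∀ x, h x = sdForm F (ratMatrix F S) x`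
(proof: `funext` + `subst`).  That is all this file does:

* `summable_norm_adelicSiegelCoeff_of_eq_sdForm` — Weil's condition (B) for `h` (the `hB` binder of `adelicSiegelFunctional`);
* `tendsto_adelicSiegelFunctional_mul_cutoff_of_eq_sdForm`, `exists_cutoff_tendsto_adelicSiegelFunctional_of_eq_sdForm` — cut-off
  continuity of `E_X` and one cut-off sequence (the Eisenstein-side `h₁` of ★ `linearMap_eq_smul_of_forall_integral_fibreMeasure_eq`);
* `integral_adelicSiegelMeasure_eq_of_mem_of_eq_sdForm` (all real `Ψ`), `tsum_adelicSiegelCoeff_eq_integral_of_eq_sdForm`,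
  `hasSum_integral_adelicSiegelFibreMeasure_of_eq_sdForm`, `tsum_adelicSiegelCoeff_eq_tsum_integral_fibre_of_eq_sdForm`,
  `hasSum_integral_adelicSiegelFibreMeasure_tsum_adelicSiegelCoeff_of_eq_sdForm` — `E_X = Σ_b μ_b` on every complex test function.

Cell `hodgecm-mathlib`, FLOOR 0, crux H413 (stmt-HodgeConjecture-24833), E-2 ∕ SW2 road (W), rows «hdom» ∕ «E-DEC glue» at `h := hNorm`
(F0P4-p06 (g3)).  HC_CM is proved only modulo the printed citations until rung 0 closes; this file is unconditional.

## References
* [Weil1965] A. Weil, *Sur la formule de Siegel dans la théorie des groupes classiques*, Acta Math. 113 (1965): Chap. I n° 2,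
  Lemmes 2–5 and Prop. 2, pp. 7–12; Chap. IV n° 40 Thm. 1 (p. 57), n° 41 (34)–(35) (p. 59).
-/

set_option autoImplicit false

noncomputable section

open MeasureTheory Filter Topology Set NumberField NumberField.InfinitePlace NumberField.mixedEmbedding IsDedekindDomain
open scoped NNReal ENNReal Matrix Classical ContDiff
open Literature.NumberTheory.Automorphic Literature.NumberTheory.Weil1964

namespace Literature.NumberTheory.Weil1965

variable (F : Type) [Field F] [NumberField F] [IsTotallyReal F] {m : ℕ}
  [MeasurableSpace (adeleQuotient F)] [BorelSpace (adeleQuotient F)]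
  [MeasurableSpace (AdeleRing (𝓞 F) F)] [BorelSpace (AdeleRing (𝓞 F) F)]
  (μ : Measure (Fin m → AdeleRing (𝓞 F) F)) [μ.IsAddHaarMeasure] (hm : 4 < m)
  {S : Matrix (Fin m) (Fin m) F} (hS : S.IsSymm) (hdet : S.det ≠ 0)
  {h : (Fin m → AdeleRing (𝓞 F) F) → AdeleRing (𝓞 F) F} (hhS : ∀ x, h x = sdForm F (ratMatrix F S) x)

omit [MeasurableSpace (adeleQuotient F)] [BorelSpace (adeleQuotient F)] in
include hm hS hdet hhS in
/-- **WEIL'S CONDITION (B) for any map `h` that is the rational quadratic form `q_S`** (`F` totally real, `S` symmetric,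
`det S ≠ 0`, `4 < m`): `Σ_{b ∈ F} ‖F*_Φ(b)‖ < ∞` for every `Φ ∈ 𝒮(𝔸_F^m)` — the `hB` binder of `adelicSiegelFunctional … h`.
[cite: Weil1965, Chap. IV n° 40 Thm. 1, p. 57; n° 41, p. 59] -/
theorem summable_norm_adelicSiegelCoeff_of_eq_sdForm {Φ : (Fin m → AdeleRing (𝓞 F) F) → ℂ}
    (hΦ : Φ ∈ piSchwartzBruhat F (Fin m)) : Summable fun b : F => ‖adelicSiegelCoeff F (Fin m) μ h Φ b‖ := by
  obtain rfl : h = fun x => sdForm F (ratMatrix F S) x := funext hhS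
  exact summable_norm_adelicSiegelCoeff_sdForm F μ hm hS hdet hΦ

variable (hh : Continuous h) (hB : ∀ Φ ∈ piSchwartzBruhat F (Fin m), Summable fun ξ : F => ‖adelicSiegelCoeff F (Fin m) μ h Φ ξ‖)

omit [MeasurableSpace (adeleQuotient F)] [BorelSpace (adeleQuotient F)] in
include hm hS hdet hhS in
/-- **CUT-OFF CONTINUITY OF `E_X` for any `h = q_S`** along tensor cut-offs `c_n = θ_n ⊗ 𝟙_{U_n}` (★
`tendsto_adelicSiegelFunctional_sdForm_mul_cutoff`, transported). [cite: Weil1965, Chap. I n° 2, Lemme 5 p. 10 and Prop. 2 p. 8; Chap. IV n° 41, p. 59] -/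
theorem tendsto_adelicSiegelFunctional_mul_cutoff_of_eq_sdForm
    {θ : ℕ → (Fin m → mixedSpace F) → ℝ} (hθs : ∀ n, ContDiff ℝ ∞ (θ n))
    (hθb : ∀ N : ℕ, ∃ C : ℝ, 0 ≤ C ∧ ∀ n, ∀ i ≤ N, ∀ y, ‖iteratedFDeriv ℝ i (θ n) y‖ ≤ C)
    {U : ℕ → Set (Fin m → FiniteAdeleRing (𝓞 F) F)} (hUc : ∀ n, IsCompact (U n)) (hUo : ∀ n, IsOpen (U n))
    (hUmono : Monotone U) (hUcov : ∀ z, ∃ n, z ∈ U n)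
    (c : ℕ → (Fin m → AdeleRing (𝓞 F) F) → ℝ)
    (hc : ∀ n v, c n v = θ n (piArch F (Fin m) v) * (U n).indicator 1 (piFinite F (Fin m) v))
    (hcS : ∀ n, c n ∈ piSchwartzBruhatReal F (Fin m)) (hc1 : ∀ n v, |c n v| ≤ 1)
    (hct : ∀ v, Tendsto (fun n => c n v) atTop (𝓝 1)) (Ψ : piSchwartzBruhatReal F (Fin m)) :
    Tendsto (fun n => adelicSiegelFunctional F (Fin m) μ h hh hB
        ⟨(Ψ : (Fin m → AdeleRing (𝓞 F) F) → ℝ) * c n, mul_mem_piSchwartzBruhatReal Ψ.2 (hcS n)⟩) atTop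
      (𝓝 (adelicSiegelFunctional F (Fin m) μ h hh hB Ψ)) := by
  obtain rfl : h = fun x => sdForm F (ratMatrix F S) x := funext hhS
  exact tendsto_adelicSiegelFunctional_sdForm_mul_cutoff F μ hm hS hdet hh hB hθs hθb hUc hUo hUmono hUcov c hc hcS hc1 hct Ψ

include hm hS hdet hhS in
/-- **ONE CUT-OFF SEQUENCE for any `h = q_S`**: `c_n ∈ 𝒮_ℝ`, `0 ≤ c_n ≤ 1`, compactly supported, eventually `1` at every point,
with `E_X(Ψ c_n) → E_X(Ψ)` for every `Ψ ∈ 𝒮_ℝ` and `∫ Ψ dE_X = E_X(Ψ)` for every `Ψ ≥ 0` (★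
`exists_cutoff_tendsto_adelicSiegelFunctional_sdForm`, transported) — the Eisenstein-side `c ∕ hc ∕ hcs ∕ h₁` of ★
`linearMap_eq_smul_of_forall_integral_fibreMeasure_eq`. [cite: Weil1965, Chap. I n° 2, Lemme 5 p. 10; Chap. IV n° 41, (35) p. 59] -/
theorem exists_cutoff_tendsto_adelicSiegelFunctional_of_eq_sdForm :
    ∃ (c : ℕ → (Fin m → AdeleRing (𝓞 F) F) → ℝ) (hcS : ∀ n, c n ∈ piSchwartzBruhatReal F (Fin m)),
      (∀ n v, c n v ∈ Icc (0 : ℝ) 1) ∧ (∀ n, HasCompactSupport (c n)) ∧ (∀ v, ∀ᶠ n in atTop, c n v = 1) ∧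
      (∀ v, Tendsto (fun n => c n v) atTop (𝓝 1)) ∧
      (∀ Ψ : piSchwartzBruhatReal F (Fin m),
        Tendsto (fun n => adelicSiegelFunctional F (Fin m) μ h hh hB
            ⟨(Ψ : (Fin m → AdeleRing (𝓞 F) F) → ℝ) * c n, mul_mem_piSchwartzBruhatReal Ψ.2 (hcS n)⟩) atTop
          (𝓝 (adelicSiegelFunctional F (Fin m) μ h hh hB Ψ))) ∧
      ∀ Ψ : piSchwartzBruhatReal F (Fin m), 0 ≤ (Ψ : (Fin m → AdeleRing (𝓞 F) F) → ℝ) →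
        Integrable (Ψ : (Fin m → AdeleRing (𝓞 F) F) → ℝ) (adelicSiegelMeasure F (Fin m) μ h hh hB) ∧
          ∫ x, (Ψ : (Fin m → AdeleRing (𝓞 F) F) → ℝ) x ∂(adelicSiegelMeasure F (Fin m) μ h hh hB) =
            adelicSiegelFunctional F (Fin m) μ h hh hB Ψ := by
  obtain rfl : h = fun x => sdForm F (ratMatrix F S) x := funext hhS
  exact exists_cutoff_tendsto_adelicSiegelFunctional_sdForm F μ hm hS hdet hh hB

include hm hS hdet hhS in
/-- **`E_X` IS ITS MEASURE on all of `𝒮_ℝ` for any `h = q_S`**: `Ψ ∈ L¹(ν_E)` and `∫ Ψ dν_E = E_X(Ψ)` for every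
`Ψ ∈ 𝒮_ℝ(𝔸_F^m)` (★ `integral_adelicSiegelMeasure_sdForm_eq_of_mem`, transported). [cite: Weil1965, Chap. IV n° 41, (35) p. 59] -/
theorem integral_adelicSiegelMeasure_eq_of_mem_of_eq_sdForm (Ψ : piSchwartzBruhatReal F (Fin m)) :
    Integrable (Ψ : (Fin m → AdeleRing (𝓞 F) F) → ℝ) (adelicSiegelMeasure F (Fin m) μ h hh hB) ∧
      ∫ x, (Ψ : (Fin m → AdeleRing (𝓞 F) F) → ℝ) x ∂(adelicSiegelMeasure F (Fin m) μ h hh hB) =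
        adelicSiegelFunctional F (Fin m) μ h hh hB Ψ := by
  obtain rfl : h = fun x => sdForm F (ratMatrix F S) x := funext hhS
  exact integral_adelicSiegelMeasure_sdForm_eq_of_mem F μ hm hS hdet hh hB Ψ

include hm hS hdet hhS in
/-- **`E_X(Ψ) = Σ_b ∫ Ψ dμ_b` (`HasSum`) for every real `Ψ ∈ 𝒮_ℝ(𝔸_F^m)` and any `h = q_S`.** [cite: Weil1965, Chap. IV n° 41, (35) p. 59] -/
theorem hasSum_integral_adelicSiegelFibreMeasure_real_of_eq_sdForm (Ψ : piSchwartzBruhatReal F (Fin m)) :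
    HasSum (fun b : F => ∫ x, (Ψ : (Fin m → AdeleRing (𝓞 F) F) → ℝ) x ∂(adelicSiegelFibreMeasure F (Fin m) μ h hh hB b))
      (adelicSiegelFunctional F (Fin m) μ h hh hB Ψ) := by
  obtain rfl : h = fun x => sdForm F (ratMatrix F S) x := funext hhS
  exact hasSum_integral_adelicSiegelFibreMeasure_sdForm_real F μ hm hS hdet hh hB Ψ

include hm hS hdet hhS in
/-- **Every complex `Φ ∈ 𝒮(𝔸_F^m)` is `ν_E`-integrable with `Σ'_ξ F*_Φ(ξ) = ∫ Φ dν_E`, for any `h = q_S`.**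
[cite: Weil1965, Chap. IV n° 41, (34)–(35) p. 59] -/
theorem tsum_adelicSiegelCoeff_eq_integral_of_eq_sdForm {Φ : (Fin m → AdeleRing (𝓞 F) F) → ℂ}
    (hΦ : Φ ∈ piSchwartzBruhat F (Fin m)) :
    Integrable Φ (adelicSiegelMeasure F (Fin m) μ h hh hB) ∧
      ∑' ξ : F, adelicSiegelCoeff F (Fin m) μ h Φ ξ = ∫ x, Φ x ∂(adelicSiegelMeasure F (Fin m) μ h hh hB) := by
  obtain rfl : h = fun x => sdForm F (ratMatrix F S) x := funext hhS
  exact tsum_adelicSiegelCoeff_sdForm_eq_integral F μ hm hS hdet hh hB hΦ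

include hm hS hdet hhS in
/-- **`∫ Φ dν_E = Σ_b ∫ Φ dμ_b` (`HasSum`) for every complex `Φ ∈ 𝒮(𝔸_F^m)` and any `h = q_S`.**
[cite: Weil1965, Chap. IV n° 41, (35) p. 59] -/
theorem hasSum_integral_adelicSiegelFibreMeasure_of_eq_sdForm {Φ : (Fin m → AdeleRing (𝓞 F) F) → ℂ}
    (hΦ : Φ ∈ piSchwartzBruhat F (Fin m)) :
    HasSum (fun b : F => ∫ x, Φ x ∂(adelicSiegelFibreMeasure F (Fin m) μ h hh hB b))
      (∫ x, Φ x ∂(adelicSiegelMeasure F (Fin m) μ h hh hB)) := by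
  obtain rfl : h = fun x => sdForm F (ratMatrix F S) x := funext hhS
  exact hasSum_integral_adelicSiegelFibreMeasure_sdForm F μ hm hS hdet hh hB hΦ

include hm hS hdet hhS in
/-- **`Σ'_ξ F*_Φ(ξ) = Σ'_b ∫ Φ dμ_b` for every complex `Φ ∈ 𝒮(𝔸_F^m)` and any `h = q_S`** — Weil's `E_X = Σ_b μ_b` on all test
functions. [cite: Weil1965, Chap. IV n° 41, (34)–(35) p. 59] -/
theorem tsum_adelicSiegelCoeff_eq_tsum_integral_fibre_of_eq_sdForm {Φ : (Fin m → AdeleRing (𝓞 F) F) → ℂ}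
    (hΦ : Φ ∈ piSchwartzBruhat F (Fin m)) :
    ∑' ξ : F, adelicSiegelCoeff F (Fin m) μ h Φ ξ = ∑' b : F, ∫ x, Φ x ∂(adelicSiegelFibreMeasure F (Fin m) μ h hh hB b) := by
  obtain rfl : h = fun x => sdForm F (ratMatrix F S) x := funext hhS
  exact tsum_adelicSiegelCoeff_sdForm_eq_tsum_integral_fibre F μ hm hS hdet hh hB hΦ

include hm hS hdet hhS in
/-- **`HasSum` landing in the Fourier side**, any `h = q_S`: `Σ_b ∫ Φ dμ_b` converges to `Σ'_ξ F*_Φ(ξ)`.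
[cite: Weil1965, Chap. IV n° 41, (34)–(35) p. 59] -/
theorem hasSum_integral_adelicSiegelFibreMeasure_tsum_adelicSiegelCoeff_of_eq_sdForm {Φ : (Fin m → AdeleRing (𝓞 F) F) → ℂ}
    (hΦ : Φ ∈ piSchwartzBruhat F (Fin m)) :
    HasSum (fun b : F => ∫ x, Φ x ∂(adelicSiegelFibreMeasure F (Fin m) μ h hh hB b))
      (∑' ξ : F, adelicSiegelCoeff F (Fin m) μ h Φ ξ) := by
  obtain rfl : h = fun x => sdForm F (ratMatrix F S) x := funext hhS
  exact hasSum_integral_adelicSiegelFibreMeasure_sdForm_tsum_adelicSiegelCoeff F μ hm hS hdet hh hB hΦ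

end Literature.NumberTheory.Weil1965

end
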